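/-
Copyright (c) 2026. All rights reserved.
Released under Apache 2.0 license as described in the file LICENSE.
Authors: abc-iut cell, seat abc-iut-L4-t14 (gen 5; proof-only assembly: [AbsTopIII] Prop 4.2 (i) «objects
of EA mapping to X id-rigid» IN PRINT'S RC-CATEGORY at the uniformised model X = ℍ/Γ̄ for Γ̄ free-or-surface,
in the PSL-normaliser hypothesis currency, and for COCOMPACT Γ̄ with no residual hypothesis).
-/
import Literature.AnabelianGeometry.AbsoluteAnabelian.ArchimedeanHolFieldFunctorGeometricRCPSLIdRigid
import Literature.AnabelianGeometry.AbsoluteAnabelian.ArchimedeanHolFieldFunctorGeometricPSLSurface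
import Literature.AnabelianGeometry.AbsoluteAnabelian.ArchimedeanHolFieldFunctorGeometricPGLNormalizerIndex
import Literature.IUT.HodgeTheaters.ProfiniteCompletionFunctorial
import HarnessLib

/-!
# [AbsTopIII] Prop 4.2 (i) in the RC-category at the uniformised model: `Γ̄` free-or-surface; cocompact `Γ̄`

S. Mochizuki, *Topics in absolute anabelian geometry III*, proof of Prop 4.2 (i) p. 106 l. 14–19 (kurims
`paper:url-5493eb38cbb7`; bib key `MochizukiAbsTopIII2015`): «the id-rigidity of `EA` follows immediately
from the slimness assertion of Lemma 4.3».  The morphisms of `EA` are the PRINT-FAITHFUL ones — RC-holomorphic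
finite étale maps (Def 4.1 (iii), Cor 2.3 (i); the tree's category `HolRS.RC`) — so `Loc_R(X)` for
`X = ℍ/Γ̄` lives in `Isom(ℍ) = PGL(2, ℝ)`.

PROOF-ONLY assembly (no definition, no named fact) generalising abc-iut-L4-t14's gen-4 RC column
(`HolRS.RC.isIdRigid_EA_mapsTo_pslQuotient_of_isFreeGroup`, p456078; hypotheses {`hfin`,
`hN' : [N_{PGL₂(ℝ)}(Λ̄) : Λ̄] < ∞`, `Γ̄` free of rank `≥ 2`}) BY NAME over abc-iut-L4-d1's
`eq_one_of_forall_commute_etaFn_normalizer_of_isFreeOrSurface` (p449698), abc-iut-L5's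
`ProfiniteCompletion.isSlimGroup_profiniteCompletion_of_surface`, the PSL→PGL normaliser bridge
`HolRS.finiteIndex_map_toPGL_normalizer` and the cocompact discharges of `…GeometricPSLSurface.lean`:

* ★ `HolRS.RC.app_self_eq_id_of_isFreeOrSurface` — **(H1⁎) in the RC-category** for `Γ̄` free-or-surface,
  non-abelian (the gen-4 argument verbatim, hypothesis (Z) of the group model now discharged by the
  free-OR-SURFACE normaliser shape and `pgl_centralizer_eq_bot`);
* ★★ `HolRS.RC.isIdRigid_EA_mapsTo_pslQuotient_of_isFreeOrSurface` (+ `…mapsTo…`, Cor 4.5) — the RC column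
  for `Γ̄` free-or-surface, non-abelian, hypotheses {`hfin`, `hN`} IN THE PSL CURRENCY (the same as the
  holomorphic column);
* ★★ `HolRS.RC.isIdRigid_EA_mapsTo_pslQuotient_of_compactSpace` / `…_of_isOrientableSurfaceGroup` (+ Cor 4.5)
  — **for a COMPACT hyperbolic Riemann surface `X₀ = ℍ/Γ̄`, `Γ̄` an orientable surface group acting freely,
  properly discontinuously and cocompactly, the geometric `EA` with PRINT-FAITHFUL morphisms over `X₀` is
  ID-RIGID and Cor 4.5 (i)–(v) holds — no residual hypothesis.**

HONEST SCOPE as in the holomorphic twin: MODEL side of [AbsTopIII] §4; `IsOrientableSurfaceGroup Γ̄`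
structural (surface classification not derived); no cocompact `Γ̄` constructed in the tree; orbi objects
and `EA` beyond one `X₀` untouched.  Classical; nothing here bears on [IUTchIII] Cor. 3.12.
-/

set_option autoImplicit false

noncomputable section

open scoped Manifold ContDiff Topology UpperHalfPlane MatrixGroups
open _root_.MulAction _root_.CategoryTheory
open Literature.AlgebraicGeometry.Frobenioids (IsSlimGroup)
open Literature.IUT.HodgeTheaters (profiniteCompletion IsFreeOrSurface IsOrientableSurfaceGroup)
open Matrix.ProjectiveSpecialLinearGroup (toPGL toPGL_mk toPGL_injective)
open Literature.Geometry.Manifold.QuotientManifold (conjSubgroup)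

namespace Literature.AnabelianGeometry.AbsoluteAnabelian

namespace HolRS

section Surface

variable (Γ : Subgroup PSL2R) [ProperlyDiscontinuousSMul Γ ℍ] [IsCancelSMul Γ ℍ]
  (hfin : ∀ (g : PSL2R) (Λ₁ Λ₂ : _root_.Literature.AnabelianGeometry.AbsoluteAnabelian.LocObj Γ),
    (∀ x ∈ Λ₁.toSubgroup, g * x * g⁻¹ ∈ Λ₂.toSubgroup) →
    ((conjSubgroup g Λ₁.toSubgroup).subgroupOf Λ₂.toSubgroup).FiniteIndex)

/-! ### `π̂₁(ℍ/Γ̄)` is slim for `Γ̄` free-or-surface -/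

/-- **`π̂₁(ℍ/Γ̄, [i])` is slim** for `Γ̄` free of finite rank or an orientable surface group, non-abelian
(`π₁(ℍ/Γ̄) ≅ Γ̄ᵐᵒᵖ` by Mathlib's `IsQuotientCoveringMap.fundamentalGroupEquiv`; the free branch by the
tree's `isSlimGroup_profiniteCompletion_of_isFreeGroup`, the surface branch by abc-iut-L5's
`ProfiniteCompletion.isSlimGroup_profiniteCompletion_of_surface`, [AbsAnab] Lem 1.3.1).
[cite: MochizukiAbsTopIII2015, Lemma 4.3 p.106] -/
theorem isSlimGroup_profiniteCompletion_fundamentalGroup_pslQuotient_of_isFreeOrSurface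
    (hΓ : IsFreeOrSurface Γ) (hab : ∃ a b : Γ, a * b ≠ b * a) :
    IsSlimGroup (profiniteCompletion
      (FundamentalGroup (pslQuotient Γ).carrier (Quotient.mk (orbitRel Γ ℍ) UpperHalfPlane.I))) := by
  have eπ : FundamentalGroup (pslQuotient Γ).carrier (Quotient.mk (orbitRel Γ ℍ) UpperHalfPlane.I) ≃*
      Γᵐᵒᵖ :=
    (isQuotientCoveringMap_quotientMk_of_properlyDiscontinuousSMul (G := Γ) (E := ℍ)).fundamentalGroupEquiv
      ⟨UpperHalfPlane.I, rfl⟩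
  let e : FundamentalGroup (pslQuotient Γ).carrier (Quotient.mk (orbitRel Γ ℍ) UpperHalfPlane.I) ≃* Γ :=
    eπ.trans (MulEquiv.inv' Γ).symm
  have hP : IsFreeOrSurface
      (FundamentalGroup (pslQuotient Γ).carrier (Quotient.mk (orbitRel Γ ℍ) UpperHalfPlane.I)) :=
    Literature.IUT.HodgeTheaters.IsFreeOrSurface.of_mulEquiv e hΓ
  have habP := Literature.GroupTheory.exists_mul_ne_mul_of_mulEquiv e hab
  rcases hP with hfree | hsurf
  · haveI := Literature.IUT.HodgeTheaters.FreeOrSurface.isFreeGroup_of_isFreeOfFiniteRank hfree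
    exact Literature.GroupTheory.isSlimGroup_profiniteCompletion_of_isFreeGroup habP
  · exact Literature.IUT.HodgeTheaters.ProfiniteCompletion.isSlimGroup_profiniteCompletion_of_surface _ hsurf

/-! ### (H1⁎) in the RC-category for `Γ̄` free-or-surface -/

include hfin in
/-- ★ **(H1⁎) for print's RC-morphisms at the uniformised model, `Γ̄` free-or-surface**, non-abelian,
acting freely and properly discontinuously on `ℍ`, `[N_{PGL₂(ℝ)}(Γ̄) : Γ̄] < ∞`: every automorphism `α` of
the identity functor of «objects of `RC` mapping to `⟨ℍ/Γ̄⟩`» has trivial component at `ℍ/Γ̄` (the gen-4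
argument `RC.app_self_eq_id_of_mulEquiv_freeGroup` verbatim; hypothesis (Z) of the group model discharged by
abc-iut-L4-d1's `eq_one_of_forall_commute_etaFn_normalizer_of_isFreeOrSurface` + `pgl_centralizer_eq_bot`).
[cite: MochizukiAbsTopIII2015, Proposition 4.2 (i) proof p.106] -/
theorem RC.app_self_eq_id_of_isFreeOrSurface (hΓ : IsFreeOrSurface Γ) (hab : ∃ a b : Γ, a * b ≠ b * a)
    [hN' : ((Γ.map (toPGL (n := Fin 2) (R := ℝ))).subgroupOf
      (Subgroup.normalizer ((Γ.map (toPGL (n := Fin 2) (R := ℝ)) : Subgroup PGL(2, ℝ)) :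
        Set PGL(2, ℝ)))).FiniteIndex]
    (α : 𝟭 (ObjectProperty.FullSubcategory fun Y : RC => Nonempty (Y ⟶ toRC.obj (pslQuotient Γ))) ≅
      𝟭 _) :
    (α.hom.app (mapsToSelf (toRC.obj (pslQuotient Γ)))).hom = 𝟙 (toRC.obj (pslQuotient Γ)) := by
  classical
  let F := pslLocFunctor Γ hfin
  let Γ' : Subgroup PGL(2, ℝ) := Γ.map (toPGL (n := Fin 2) (R := ℝ))
  let C := ObjectProperty.FullSubcategory fun Y : RC => Nonempty (Y ⟶ toRC.obj (pslQuotient Γ))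
  let A : _root_.Literature.AnabelianGeometry.AbsoluteAnabelian.LocObj Γ → C := fun Λ =>
    ⟨toRC.obj (F.obj Λ), (nonempty_hom_pslLocFunctor_obj Γ hfin Λ).map toRC.map⟩
  -- the components at the `ℍ/Λ̄` come from `PGL(2, ℝ)` (sign-free RC fullness)
  have key : ∀ Λ : _root_.Literature.AnabelianGeometry.AbsoluteAnabelian.LocObj Γ, ∃ q : PGL(2, ℝ),
      (∀ τ : ℍ, (α.hom.app (A Λ)).hom.toFun (Quotient.mk (orbitRel Λ.toSubgroup ℍ) τ) =
        Quotient.mk (orbitRel Λ.toSubgroup ℍ) (q • τ)) ∧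
      ∀ x ∈ Λ.toSubgroup, q * toPGL x * q⁻¹ ∈ Λ.toSubgroup.map (toPGL (n := Fin 2) (R := ℝ)) := by
    intro Λ
    haveI : ProperlyDiscontinuousSMul Λ.toSubgroup ℍ :=
      Subgroup.properlyDiscontinuousSMul_of_le ‹ProperlyDiscontinuousSMul Γ ℍ› Λ.le
    haveI : IsCancelSMul Λ.toSubgroup ℍ := isCancelSMul_of_le upperHalfPlane Γ Λ.le
    exact RC.exists_pgl_of_hom Λ.toSubgroup Λ.toSubgroup (α.hom.app (A Λ)).hom
  choose x hx hxconj using key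
  -- naturality along `[g] : Λ₁ → Λ₂` read in `PGL(2, ℝ)`: `(g x_{Λ₁}) (x_{Λ₂} g)⁻¹ ∈ Λ̄₂`
  have hnat : ∀ {Λ₁ Λ₂ : _root_.Literature.AnabelianGeometry.AbsoluteAnabelian.LocObj Γ} (g : PSL2R)
      (hg : ∀ y ∈ Λ₁.toSubgroup, g * y * g⁻¹ ∈ Λ₂.toSubgroup),
      toPGL g * x Λ₁ * (x Λ₂ * toPGL g)⁻¹ ∈ Λ₂.toSubgroup.map (toPGL (n := Fin 2) (R := ℝ)) := by
    intro Λ₁ Λ₂ g hg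
    haveI : ProperlyDiscontinuousSMul Λ₂.toSubgroup ℍ :=
      Subgroup.properlyDiscontinuousSMul_of_le ‹ProperlyDiscontinuousSMul Γ ℍ› Λ₂.le
    haveI : IsCancelSMul Λ₂.toSubgroup ℍ := isCancelSMul_of_le upperHalfPlane Γ Λ₂.le
    let φ : A Λ₁ ⟶ A Λ₂ := ObjectProperty.homMk (toRC.map (F.map (LocObj.homMk g hg)))
    have hφ := α.hom.naturality φ
    refine RC.mul_inv_mem_of_forall_mk_smul_eq Λ₂.toSubgroup fun τ => ?_
    have e1 := congrArg (fun k : A Λ₁ ⟶ A Λ₂ => k.hom.toFun (Quotient.mk (orbitRel Λ₁.toSubgroup ℍ) τ)) hφ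
    simp only [Functor.id_map, Functor.id_obj] at e1
    change (α.hom.app (A Λ₂)).hom.toFun ((toRC.map (F.map (LocObj.homMk g hg))).toFun
        (Quotient.mk (orbitRel Λ₁.toSubgroup ℍ) τ)) =
      (toRC.map (F.map (LocObj.homMk g hg))).toFun ((α.hom.app (A Λ₁)).hom.toFun
        (Quotient.mk (orbitRel Λ₁.toSubgroup ℍ) τ)) at e1
    rw [hx Λ₁ τ, toRC_map_toFun] at e1
    erw [LocObj.toHolRS_map_homMk_toFun_mk, LocObj.toHolRS_map_homMk_toFun_mk] at e1
    rw [hx Λ₂] at e1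
    rw [mul_smul, mul_smul, toPGL_smul, toPGL_smul]
    exact e1
  -- the component at `X` itself lies in the normaliser of `Γ̄'` (invertibility of `α_X`)
  have htop : x (LocObj.top Γ) ∈ Subgroup.normalizer (Γ' : Set PGL(2, ℝ)) := by
    obtain ⟨qt, hqt, hqtconj⟩ := RC.exists_pgl_of_hom Γ Γ (α.inv.app (A (LocObj.top Γ))).hom
    -- `x_top * qt ∈ Γ̄'` from `α.inv ≫ α.hom = 𝟙`
    have hcomp : ∀ τ : ℍ, Quotient.mk (orbitRel Γ ℍ) ((x (LocObj.top Γ) * qt) • τ) =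
        Quotient.mk (orbitRel Γ ℍ) ((1 : PGL(2, ℝ)) • τ) := by
      intro τ
      have e0 := congrArg (fun k : A (LocObj.top Γ) ⟶ A (LocObj.top Γ) =>
        k.hom.toFun (Quotient.mk (orbitRel Γ ℍ) τ)) (α.inv_hom_id_app (A (LocObj.top Γ)))
      change (α.hom.app (A (LocObj.top Γ))).hom.toFun ((α.inv.app (A (LocObj.top Γ))).hom.toFun
        (Quotient.mk (orbitRel Γ ℍ) τ)) = Quotient.mk (orbitRel Γ ℍ) τ at e0
      rw [hqt τ] at e0
      erw [hx (LocObj.top Γ)] at e0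
      rw [mul_smul, one_smul]
      exact e0
    have hmem : (1 : PGL(2, ℝ)) * (x (LocObj.top Γ) * qt)⁻¹ ∈ Γ' :=
      RC.mul_inv_mem_of_forall_mk_smul_eq Γ hcomp
    rw [one_mul, Subgroup.inv_mem_iff] at hmem
    -- `x_top Γ̄' x_top⁻¹ ≤ Γ̄'` (from `hxconj`) and `x_top⁻¹ Γ̄' x_top ≤ Γ̄'` (from `qt`)
    rw [Subgroup.mem_normalizer_iff]
    intro y
    constructor
    · intro hy
      obtain ⟨z, hz, rfl⟩ := Subgroup.mem_map.mp hy
      exact hxconj (LocObj.top Γ) z hz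
    · intro hy
      -- `y = x⁻¹ (x y x⁻¹) x = qt μ⁻¹ (x y x⁻¹) μ qt⁻¹` with `μ := x qt ∈ Γ̄'`
      have h3 : qt * ((x (LocObj.top Γ) * qt)⁻¹ * (x (LocObj.top Γ) * y * (x (LocObj.top Γ))⁻¹) *
          (x (LocObj.top Γ) * qt)) * qt⁻¹ = y := by group
      rw [← h3]
      have h4 : (x (LocObj.top Γ) * qt)⁻¹ * (x (LocObj.top Γ) * y * (x (LocObj.top Γ))⁻¹) *
          (x (LocObj.top Γ) * qt) ∈ Γ' :=
        Γ'.mul_mem (Γ'.mul_mem (Γ'.inv_mem hmem) hy) hmem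
      obtain ⟨z, hz, hz'⟩ := Subgroup.mem_map.mp h4
      rw [← hz']
      exact hqtconj z hz
  -- every component lies in `N(Γ̄')`: `x_Λ ∈ Γ̄' x_top`
  have hxN : ∀ Λ : _root_.Literature.AnabelianGeometry.AbsoluteAnabelian.LocObj Γ,
      x Λ ∈ Subgroup.normalizer (Γ' : Set PGL(2, ℝ)) := by
    intro Λ
    have h1 := hnat (Λ₁ := Λ) (Λ₂ := LocObj.top Γ) 1 (fun y hy => by simpa using Λ.le hy)
    rw [map_one, one_mul, mul_one] at h1
    have h3 : x Λ = (x Λ * (x (LocObj.top Γ))⁻¹) * x (LocObj.top Γ) := by group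
    rw [h3]
    exact (Subgroup.normalizer _).mul_mem (Subgroup.le_normalizer h1) htop
  -- the family on the objects of `Loc(PGL₂(ℝ), Γ̄')`
  let pre : _root_.Literature.AnabelianGeometry.AbsoluteAnabelian.LocObj Γ' →
      _root_.Literature.AnabelianGeometry.AbsoluteAnabelian.LocObj Γ := fun Λ' =>
    { toSubgroup := Λ'.toSubgroup.comap (toPGL (n := Fin 2) (R := ℝ))
      le := fun y hy => by
        have : toPGL y ∈ Γ' := Λ'.le hy
        obtain ⟨z, hz, hzy⟩ := Subgroup.mem_map.mp this
        rwa [← toPGL_injective hzy]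
      finiteIndex := by
        haveI := Λ'.finiteIndex
        -- `[Γ̄ : toPGL⁻¹ Λ'] = [Γ̄' : Λ']` along `Γ̄ ≃* Γ̄'`
        let eΓ : Γ ≃* Γ' := Subgroup.equivMapOfInjective Γ _ toPGL_injective
        have hcomap : (Λ'.toSubgroup.comap (toPGL (n := Fin 2) (R := ℝ))).subgroupOf Γ =
            (Λ'.toSubgroup.subgroupOf Γ').comap eΓ.toMonoidHom := by
          ext y
          rw [Subgroup.mem_subgroupOf, Subgroup.mem_comap, Subgroup.mem_comap, Subgroup.mem_subgroupOf,
            MulEquiv.coe_toMonoidHom, Subgroup.coe_equivMapOfInjective_apply]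
        refine ⟨?_⟩
        rw [hcomap, Subgroup.index_comap_of_surjective _ eΓ.surjective]
        exact Subgroup.FiniteIndex.index_ne_zero }
  have hpre_le : ∀ {Λ' Λ'' : _root_.Literature.AnabelianGeometry.AbsoluteAnabelian.LocObj Γ'},
      Λ''.toSubgroup ≤ Λ'.toSubgroup → (pre Λ'').toSubgroup ≤ (pre Λ').toSubgroup :=
    fun h => Subgroup.comap_mono h
  have hpre_map : ∀ Λ' : _root_.Literature.AnabelianGeometry.AbsoluteAnabelian.LocObj Γ',
      (pre Λ').toSubgroup.map (toPGL (n := Fin 2) (R := ℝ)) ≤ Λ'.toSubgroup :=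
    fun Λ' => Subgroup.map_comap_le _ _
  -- hypothesis (Z) of the group model `Loc(PGL₂(ℝ), Γ̄')`, discharged by abc-iut-L4-d1's free-or-surface
  -- normaliser shape and `C_{PGL₂(ℝ)}(Γ̄) = 1`
  have hΓ' : IsFreeOrSurface Γ' :=
    Literature.IUT.HodgeTheaters.IsFreeOrSurface.of_mulEquiv
      (Subgroup.equivMapOfInjective Γ _ toPGL_injective).symm hΓ
  have hC : ∀ g ∈ Subgroup.normalizer (Γ' : Set PGL(2, ℝ)), (∀ γ ∈ Γ', g * γ = γ * g) → g = 1 := by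
    intro g _ hg
    have hmem : g ∈ Subgroup.centralizer (Γ' : Set PGL(2, ℝ)) := by
      rw [Subgroup.mem_centralizer_iff]
      exact fun y hy => (hg y hy).symm
    rwa [pgl_centralizer_eq_bot Γ hab, Subgroup.mem_bot] at hmem
  have hZ : LocObj.CentralFamiliesTrivial Γ' :=
    LocObj.centralFamiliesTrivial_of_completion_normalizer
      (Literature.GroupTheory.eq_one_of_forall_commute_etaFn_normalizer_of_isFreeOrSurface Γ' hΓ' hC)
  -- apply (Z) to the family `x ∘ pre` at the object `Γ̄'` itself
  have hconcl := hZ (fun Λ' => x (pre Λ')) (fun Λ' _ => hxN (pre Λ'))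
    (fun Λ' Λ'' _ _ hle => by
      -- compatibility from naturality along `[1] : pre Λ'' → pre Λ'`
      have h1 := hnat (Λ₁ := pre Λ'') (Λ₂ := pre Λ') 1 (fun y hy => by simpa using hpre_le hle hy)
      rw [map_one, one_mul, mul_one] at h1
      have h3 := hpre_map Λ' h1
      rw [← Subgroup.inv_mem_iff] at h3
      simpa using h3)
    (fun Λ' hΛ' γ hγ => by
      -- centrality from naturality along the deck transformation `[g] : pre Λ' → pre Λ'`
      obtain ⟨g, hg, rfl⟩ := Subgroup.mem_map.mp hγ
      have hnormal : ∀ y ∈ (pre Λ').toSubgroup, g * y * g⁻¹ ∈ (pre Λ').toSubgroup := by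
        intro y hy
        change toPGL (g * y * g⁻¹) ∈ Λ'.toSubgroup
        rw [map_mul, map_mul, map_inv]
        exact hΛ' _ (Subgroup.mem_map_of_mem _ hg) _ hy
      have h1 := hpre_map Λ' (hnat (Λ₁ := pre Λ') (Λ₂ := pre Λ') g hnormal)
      rw [← Subgroup.inv_mem_iff] at h1
      have e3 : (toPGL g * x (pre Λ') * (x (pre Λ') * toPGL g)⁻¹)⁻¹ =
          x (pre Λ') * toPGL g * (x (pre Λ'))⁻¹ * (toPGL g)⁻¹ := by group
      rwa [e3] at h1)
    (LocObj.top Γ') (fun γ hγ y hy => Γ'.mul_mem (Γ'.mul_mem hγ hy) (Γ'.inv_mem hγ))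
  have hpretop : pre (LocObj.top Γ') = LocObj.top Γ :=
    LocObj.ext_toSubgroup (Subgroup.comap_map_eq_self_of_injective toPGL_injective Γ)
  rw [hpretop] at hconcl
  change x (LocObj.top Γ) ∈ Γ' at hconcl
  obtain ⟨g₀, hg₀, hg₀x⟩ := Subgroup.mem_map.mp hconcl
  apply RC.hom_ext
  funext p
  induction p using Quotient.inductionOn with
  | h τ =>
    change (α.hom.app (A (LocObj.top Γ))).hom.toFun (Quotient.mk (orbitRel Γ ℍ) τ) =
      Quotient.mk (orbitRel Γ ℍ) τ
    erw [hx (LocObj.top Γ) τ]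
    rw [← hg₀x, toPGL_smul]
    exact Quotient.sound ⟨⟨g₀, hg₀⟩, rfl⟩

include hfin in
/-- ★ **[AbsTopIII] Prop 4.2 (i) in print's RC-category at the uniformised model: «objects of `RC` mapping
to `ℍ/Γ̄`» is ID-RIGID** for `Γ̄` free-or-surface, non-abelian, acting freely and properly discontinuously,
`[N_{PGL₂(ℝ)}(Γ̄) : Γ̄] < ∞` (descent from (H1⁎) + abc-iut-L4-t12's id-rigidity of the RC slice).
[cite: MochizukiAbsTopIII2015, Proposition 4.2 (i) proof p.106] -/
theorem RC.isIdRigid_mapsTo_pslQuotient_of_isFreeOrSurface (hΓ : IsFreeOrSurface Γ)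
    (hab : ∃ a b : Γ, a * b ≠ b * a)
    [((Γ.map (toPGL (n := Fin 2) (R := ℝ))).subgroupOf
      (Subgroup.normalizer ((Γ.map (toPGL (n := Fin 2) (R := ℝ)) : Subgroup PGL(2, ℝ)) :
        Set PGL(2, ℝ)))).FiniteIndex] :
    IsIdRigid (ObjectProperty.FullSubcategory fun Y : RC => Nonempty (Y ⟶ toRC.obj (pslQuotient Γ))) :=
  isIdRigid_mapsTo_of_app_self_eq_id (toRC.obj (pslQuotient Γ))
    (RC.app_self_eq_id_of_isFreeOrSurface Γ hfin hΓ hab)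
    (RC.isIdRigid_over_of_isSlimGroup (pslQuotient Γ) (Quotient.mk (orbitRel Γ ℍ) UpperHalfPlane.I)
      (isSlimGroup_profiniteCompletion_fundamentalGroup_pslQuotient_of_isFreeOrSurface Γ hΓ hab))

include hfin in
/-- ★★ **The geometric `EA` with PRINT-FAITHFUL (RC-holomorphic) morphisms over `X₀ = ℍ/Γ̄` is ID-RIGID**
for `Γ̄` free-or-surface, non-abelian, acting freely and properly discontinuously on `ℍ`, provided
`[N_{PSL₂(ℝ)}(Λ̄) : Λ̄] < ∞` for every finite-index `Λ̄ ≤ Γ̄` — the SAME hypotheses {`hfin`, `hN`} as the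
holomorphic column (PSL→PGL bridge at each object). [cite: MochizukiAbsTopIII2015, Proposition 4.2 (i) proof p.106] -/
theorem RC.isIdRigid_EA_mapsTo_pslQuotient_of_isFreeOrSurface (hΓ : IsFreeOrSurface Γ)
    (hab : ∃ a b : Γ, a * b ≠ b * a)
    (hN : ∀ Λ : _root_.Literature.AnabelianGeometry.AbsoluteAnabelian.LocObj Γ,
      (Λ.toSubgroup.subgroupOf (Subgroup.normalizer (Λ.toSubgroup : Set PSL2R))).FiniteIndex) :
    IsIdRigid (geometricAutHolFieldFunctorRC fun Y : RC => Nonempty (Y ⟶ toRC.obj (pslQuotient Γ))).EA := by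
  let Q : ObjectProperty RC := fun Y : RC => Nonempty (Y ⟶ toRC.obj (pslQuotient Γ))
  have hQ : ∀ {Y Z : RC}, (Y ⟶ Z) → Q Z → Q Y := fun f ⟨g⟩ => ⟨f ≫ g⟩
  change IsIdRigid Q.FullSubcategory
  refine isIdRigid_of_forall_isIdRigid_mapsTo fun X => ?_
  rw [isIdRigid_mapsTo_fullSubcategory_iff Q hQ X]
  -- `X ≅ ℍ/Λ̄` in `RC` for some finite-index `Λ̄ ≤ Γ̄`
  obtain ⟨fX⟩ := X.property
  obtain ⟨eC, -, -⟩ := RC.exists_iso_ofCover (pslQuotient Γ) (Y := X.obj.of) fX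
  obtain ⟨Λ, ⟨eΛ⟩⟩ := exists_iso_pslLocFunctor_obj Γ hfin
    ((pslQuotient Γ).ofCover fX.isFiniteEtale.isCoveringMap fX.isFiniteEtale.finite_fibre)
    ((pslQuotient Γ).ofCoverHom fX.isFiniteEtale.isCoveringMap fX.isFiniteEtale.finite_fibre)
  haveI : ProperlyDiscontinuousSMul Λ.toSubgroup ℍ :=
    Subgroup.properlyDiscontinuousSMul_of_le ‹ProperlyDiscontinuousSMul Γ ℍ› Λ.le
  haveI : IsCancelSMul Λ.toSubgroup ℍ := isCancelSMul_of_le upperHalfPlane Γ Λ.le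
  haveI := hN Λ
  haveI := finiteIndex_map_toPGL_normalizer Λ.toSubgroup
  let i : toRC.obj (pslQuotient Λ.toSubgroup) ≅ X.obj := (toRC.mapIso eΛ).trans eC
  have hP : (fun Z : RC => Nonempty (Z ⟶ X.obj)) =
      fun Z : RC => Nonempty (Z ⟶ toRC.obj (pslQuotient Λ.toSubgroup)) := by
    funext Z
    exact propext ⟨fun ⟨f⟩ => ⟨f ≫ i.inv⟩, fun ⟨f⟩ => ⟨f ≫ i.hom⟩⟩
  rw [hP]
  exact RC.isIdRigid_mapsTo_pslQuotient_of_isFreeOrSurface Λ.toSubgroup (hfin_of_locObj Γ hfin Λ)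
    (HolRS.LocObj.isFreeOrSurface hΓ Λ) (HolRS.LocObj.exists_mul_ne_mul_of_isFreeOrSurface hΓ hab Λ)

include hfin in
/-- ★ **[AbsTopIII] Cor 4.5 (i)–(v) over the geometric `EA` with PRINT-FAITHFUL morphisms over
`X₀ = ℍ/Γ̄`**, `Γ̄` free-or-surface, non-abelian, hypotheses {`hfin`, `hN`} (abc-iut-L4-t10's
`cor_4_5_geometricRC`). [cite: MochizukiAbsTopIII2015, Corollary 4.5 pp.107–109] -/
theorem RC.cor_4_5_geometric_mapsTo_pslQuotient_of_isFreeOrSurface (hΓ : IsFreeOrSurface Γ)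
    (hab : ∃ a b : Γ, a * b ≠ b * a)
    (hN : ∀ Λ : _root_.Literature.AnabelianGeometry.AbsoluteAnabelian.LocObj Γ,
      (Λ.toSubgroup.subgroupOf (Subgroup.normalizer (Λ.toSubgroup : Set PSL2R))).FiniteIndex) :
    Literature.AnabelianGeometry.AbsoluteAnabelian.AbsTopIII.Cor_4_5
      (archLogFrobeniusData
        (geometricAutHolFieldFunctorRC fun Y : RC => Nonempty (Y ⟶ toRC.obj (pslQuotient Γ))))
      (archTelecoreData
        (geometricAutHolFieldFunctorRC fun Y : RC => Nonempty (Y ⟶ toRC.obj (pslQuotient Γ)))) :=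
  cor_4_5_geometricRC _ ⟨toRC.obj (pslQuotient Γ), ⟨𝟙 _⟩⟩
    (RC.isIdRigid_EA_mapsTo_pslQuotient_of_isFreeOrSurface Γ hfin hΓ hab hN)

end Surface

/-! ### The COCOMPACT RC column: no residual hypothesis -/

section Cocompact

variable (Γ : Subgroup PSL2R) [ProperlyDiscontinuousSMul Γ ℍ] [IsCancelSMul Γ ℍ]
  [CompactSpace (orbitRel.Quotient Γ ℍ)]

/-- ★★ **[AbsTopIII] Prop 4.2 (i), PRINT-FAITHFUL morphisms, COMPACT `X₀`**: the geometric `EA` of the RC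
instance over `X₀ = ℍ/Γ̄` is ID-RIGID for `Γ̄` free-or-surface, non-abelian, acting freely, properly
discontinuously and COCOMPACTLY — `hfin`, `hN` discharged. [cite: MochizukiAbsTopIII2015, Proposition 4.2 (i) proof p.106] -/
theorem RC.isIdRigid_EA_mapsTo_pslQuotient_of_compactSpace (hΓ : IsFreeOrSurface Γ)
    (hab : ∃ a b : Γ, a * b ≠ b * a) :
    IsIdRigid (geometricAutHolFieldFunctorRC fun Y : RC => Nonempty (Y ⟶ toRC.obj (pslQuotient Γ))).EA :=
  RC.isIdRigid_EA_mapsTo_pslQuotient_of_isFreeOrSurface Γ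
    (finiteIndex_conjSubgroup_subgroupOf_of_compactSpace Γ) hΓ hab
    (HolRS.LocObj.finiteIndex_subgroupOf_normalizer_of_compactSpace hΓ hab)

/-- ★★ **The same for `Γ̄` an orientable surface group**: the geometric `EA` with print-faithful morphisms
over the compact hyperbolic Riemann surface `X₀ = ℍ/Γ̄` is ID-RIGID — structural data only.
[cite: MochizukiAbsTopIII2015, Proposition 4.2 (i) proof p.106] -/
theorem RC.isIdRigid_EA_mapsTo_pslQuotient_of_isOrientableSurfaceGroup (hΓ : IsOrientableSurfaceGroup Γ) :
    IsIdRigid (geometricAutHolFieldFunctorRC fun Y : RC => Nonempty (Y ⟶ toRC.obj (pslQuotient Γ))).EA :=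
  RC.isIdRigid_EA_mapsTo_pslQuotient_of_compactSpace Γ (Or.inr hΓ)
    (exists_mul_ne_mul_of_isOrientableSurfaceGroup Γ hΓ)

/-- ★★ **[AbsTopIII] Cor 4.5 (i)–(v), PRINT-FAITHFUL morphisms, over a COMPACT `X₀ = ℍ/Γ̄`**, `Γ̄`
free-or-surface, non-abelian, acting freely, properly discontinuously and cocompactly — no residual
hypothesis. [cite: MochizukiAbsTopIII2015, Corollary 4.5 pp.107–109] -/
theorem RC.cor_4_5_geometric_mapsTo_pslQuotient_of_compactSpace (hΓ : IsFreeOrSurface Γ)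
    (hab : ∃ a b : Γ, a * b ≠ b * a) :
    Literature.AnabelianGeometry.AbsoluteAnabelian.AbsTopIII.Cor_4_5
      (archLogFrobeniusData
        (geometricAutHolFieldFunctorRC fun Y : RC => Nonempty (Y ⟶ toRC.obj (pslQuotient Γ))))
      (archTelecoreData
        (geometricAutHolFieldFunctorRC fun Y : RC => Nonempty (Y ⟶ toRC.obj (pslQuotient Γ)))) :=
  RC.cor_4_5_geometric_mapsTo_pslQuotient_of_isFreeOrSurface Γ
    (finiteIndex_conjSubgroup_subgroupOf_of_compactSpace Γ) hΓ hab
    (HolRS.LocObj.finiteIndex_subgroupOf_normalizer_of_compactSpace hΓ hab)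

/-- ★★ **[AbsTopIII] Cor 4.5 (i)–(v), print-faithful morphisms, over the compact hyperbolic Riemann surface
`X₀ = ℍ/Γ̄`, `Γ̄` an orientable surface group** — structural data only.
[cite: MochizukiAbsTopIII2015, Corollary 4.5 pp.107–109] -/
theorem RC.cor_4_5_geometric_mapsTo_pslQuotient_of_isOrientableSurfaceGroup
    (hΓ : IsOrientableSurfaceGroup Γ) :
    Literature.AnabelianGeometry.AbsoluteAnabelian.AbsTopIII.Cor_4_5
      (archLogFrobeniusData
        (geometricAutHolFieldFunctorRC fun Y : RC => Nonempty (Y ⟶ toRC.obj (pslQuotient Γ))))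
      (archTelecoreData
        (geometricAutHolFieldFunctorRC fun Y : RC => Nonempty (Y ⟶ toRC.obj (pslQuotient Γ)))) :=
  RC.cor_4_5_geometric_mapsTo_pslQuotient_of_compactSpace Γ (Or.inr hΓ)
    (exists_mul_ne_mul_of_isOrientableSurfaceGroup Γ hΓ)

end Cocompact

end HolRS

end Literature.AnabelianGeometry.AbsoluteAnabelian

end
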